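import Literature.Analysis.FluidPDE.PeriodicCylinderCoordinates
import HarnessLib

/-!
# The Gauss–Green identity on the period cell of the cylinder with the flux through the wall

Topic `Literature/Analysis/FluidPDE`. For a vector field `G` of class `C¹` on the closed cylinder
`{r ≤ 1}` and `L`-periodic in `z`, the integral of `div G` over the period cell equals the flux
through the wall `{r = 1}`:

`∫_{{r<1} × (0,L)} div G dx = ∫_{[-π,π] × [0,L]} ⟪G(cos θ, sin θ, z), e_r(θ)⟫ d(θ, z)`

(`setIntegral_divergence_cylinderCell_eq_wallFlux`; the wall carries the surface measure
`dθ dz` of the unit cylinder). The tangential case (flux zero) is the tree's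
`setIntegral_mul_divergence_cylCoord_eq_zero` (`PeriodicCylinderFlux.lean`, parameter box) /
`setIntegral_divergence_periodCell_eq_zero` (`PeriodicCylinderGaussGreen.lean`, physical cell by
a cut-off argument); here the wall term is kept, which is what integration by parts **with
boundary terms** on the cell requires — Green's identities for the Neumann problem of the
pressure (Ferrari 1993, Lemma 2, (10)–(12) p. 281; Kato–Lai 1984, §4 (4.4)–(4.6)), trace
estimates on the wall, and the Gagliardo–Nirenberg inequalities of Ferrari's Lemma 1 on the
bounded domain. Consequences recorded: the directional integration-by-parts formula
`∫_cell Dφ(x) v dx = ∫_wall φ ⟪v, e_r⟫` for scalar `φ` (`setIntegral_fderiv_apply_cylinderCell_eq_wallFlux`).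

## Proof

On the parameter box `[0,1] × [-π,π] × [0,L]` this is Mathlib's divergence theorem for the flux
components `cylFlux G` exactly as in `PeriodicCylinderFlux.lean` (`sum_fderiv_cylFlux`:
`∂_r f₀ + ∂_θ f₁ + ∂_z f₂ = r (div G)∘Φ`), all faces cancelling (`θ = ±π` equal, `z = 0, L` equal
by periodicity, `f₀ = r ⟪G, e_r⟫ = 0` at `r = 0`) except the wall `r = 1`, where
`f₀ = ⟪G∘Φ, e_r⟫` (`setIntegral_mul_divergence_cylBox_eq_wallFlux`). The change of variables
`setIntegral_cylinderCell_eq_integral_cylBoxOpen` (`PeriodicCylinderCoordinates.lean`) carries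
the left-hand side to the physical cell. All statements are folklore calculus (Gauss–Green).

## Mathlib / tree search

As for `PeriodicCylinderFlux`/`PeriodicCylinderGaussGreen`: Mathlib has the divergence theorem on
boxes only (`MeasureTheory.integral_divergence_of_hasFDerivAt_off_countable'`); the tree's cell
versions are the tangential (zero-flux) ones quoted above.
-/

noncomputable section

open MeasureTheory Set Function Filter Topology TopologicalSpace WithLp Real
open scoped ContDiff NNReal ENNReal InnerProductSpace RealInnerProductSpace

namespace Literature.Analysis.FluidPDE

/-! ### The wall of the period cell in the parameters `(θ, z)` -/

/-- The parameter rectangle `[-π, π] × [0, L]` of the wall `{r = 1, 0 ≤ z ≤ L}` of the period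
cell, as the `r = 1` face `Icc (cylBoxLo ∘ succAbove 0) (cylBoxHi L ∘ succAbove 0)` of the box of
`PeriodicCylinderFlux` (points `y : Fin 2 → ℝ`, `y 0 = θ`, `y 1 = z`). [folklore] -/
def cylWall (L : ℝ) : Set (Fin 2 → ℝ) :=
  Icc (cylBoxLo ∘ Fin.succAbove 0) (cylBoxHi L ∘ Fin.succAbove 0)

/-- `cylWall L = [-π, π] × [0, L]`. [folklore] -/
theorem cylWall_eq (L : ℝ) : cylWall L = Icc ![-π, 0] ![π, L] := by
  have h1 : (cylBoxLo ∘ Fin.succAbove 0 : Fin 2 → ℝ) = ![-π, 0] := by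
    funext j; fin_cases j <;> rfl
  have h2 : (cylBoxHi L ∘ Fin.succAbove 0 : Fin 2 → ℝ) = ![π, L] := by
    funext j; fin_cases j <;> rfl
  rw [cylWall, h1, h2]

/-- Membership in the wall rectangle. [folklore] -/
theorem mem_cylWall_iff {L : ℝ} {y : Fin 2 → ℝ} :
    y ∈ cylWall L ↔ y 0 ∈ Icc (-π) π ∧ y 1 ∈ Icc 0 L := by
  rw [cylWall_eq, mem_Icc, Pi.le_def, Pi.le_def, Fin.forall_fin_two, Fin.forall_fin_two]
  simp only [Matrix.cons_val_zero, Matrix.cons_val_one, mem_Icc]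
  tauto

/-- The point of parameter space on the wall above `y = (θ, z)`: `(1, θ, z)`. [folklore] -/
theorem insertNth_zero_one_apply (y : Fin 2 → ℝ) :
    (Fin.insertNth 0 (1 : ℝ) y : Fin 3 → ℝ) 0 = 1 ∧ (Fin.insertNth 0 (1 : ℝ) y : Fin 3 → ℝ) 1 = y 0 ∧
      (Fin.insertNth 0 (1 : ℝ) y : Fin 3 → ℝ) 2 = y 1 := by
  refine ⟨by simp, ?_, ?_⟩
  · simp
  · have := Fin.insertNth_apply_succAbove (α := fun _ => ℝ) 0 (1 : ℝ) y 1
    simpa using this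

/-- The physical point of the wall above `y = (θ, z)`: `Φ(1, θ, z) = (cos θ, sin θ, z)`. [folklore] -/
theorem cylCoord_insertNth_zero_one (y : Fin 2 → ℝ) :
    cylCoord (Fin.insertNth 0 (1 : ℝ) y) = frameR (y 0) + (y 1) • eZ := by
  obtain ⟨h0, h1, h2⟩ := insertNth_zero_one_apply y
  rw [cylCoord, h0, h1, h2, one_smul]

/-- On the wall `f₀ = ⟪G∘Φ, e_r⟫`; on the axis face `r = 0`, `f₀ = 0`. [folklore] -/
theorem cylFlux_zero_rface' (G : EuclideanSpace ℝ (Fin 3) → EuclideanSpace ℝ (Fin 3))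
    (y : Fin 2 → ℝ) :
    cylFlux G 0 (Fin.insertNth 0 (1 : ℝ) y) =
        ⟪G (cylCoord (Fin.insertNth 0 (1 : ℝ) y)), frameR (y 0)⟫ ∧
      cylFlux G 0 (Fin.insertNth 0 (0 : ℝ) y) = 0 := by
  obtain ⟨h0, h1, -⟩ := insertNth_zero_one_apply y
  refine ⟨?_, by simp⟩
  rw [cylFlux_zero, h0, h1, one_mul]

/-! ### The flux identity on the parameter box -/

/-- **Divergence theorem on the period cell in cylindrical coordinates, with the wall flux**:
for `G` of class `C¹` on the closed cylinder `{r ≤ 1}` and `L`-periodic in `z` (`L ≥ 0`),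
`∫_{[0,1]×[−π,π]×[0,L]} r · (div G)(Φ p) dp = ∫_{[-π,π]×[0,L]} ⟪G(Φ(1,θ,z)), e_r(θ)⟫ d(θ,z)`.
Mathlib's divergence theorem on the box for the flux components `cylFlux G`
(`sum_fderiv_cylFlux`), the `θ`- and `z`-faces cancelling (`cylFlux_one_thetaface`,
`cylFlux_two_zface`) and the axis face vanishing; the proof is that of
`setIntegral_mul_divergence_cylCoord_eq_zero` with the wall face kept. [folklore] -/
theorem setIntegral_mul_divergence_cylBox_eq_wallFlux
    {G : EuclideanSpace ℝ (Fin 3) → EuclideanSpace ℝ (Fin 3)} {L : ℝ} (hL : 0 ≤ L)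
    (hG : ContDiffOn ℝ 1 G (closure (unitCylinder : Set (EuclideanSpace ℝ (Fin 3)))))
    (hper : IsAxiallyPeriodic L G) :
    ∫ p in cylBox L, p 0 * VectorCalculus.divergence G (cylCoord p) =
      ∫ y in cylWall L, ⟪G (cylCoord (Fin.insertNth 0 (1 : ℝ) y)), frameR (y 0)⟫ := by
  set K : Set (EuclideanSpace ℝ (Fin 3)) := closure (unitCylinder : Set (EuclideanSpace ℝ (Fin 3)))
    with hK
  have hKu : UniqueDiffOn ℝ K :=
    uniqueDiffOn_convex convex_unitCylinder.closure
      ⟨0, interior_mono subset_closure (by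
        rw [unitCylinder.isOpen.interior_eq]; exact zero_mem_unitCylinder)⟩
  -- `G` is differentiable at the image of the open box, with `fderiv = fderivWithin K`
  have hKn : ∀ p ∈ cylBoxOpen L, K ∈ 𝓝 (cylCoord p) := fun p hp =>
    mem_of_superset (unitCylinder.isOpen.mem_nhds (cylCoord_mem_of_mem_cylBoxOpen hp))
      subset_closure
  have hGd : ∀ p ∈ cylBoxOpen L, HasFDerivAt G (fderivWithin ℝ G K (cylCoord p)) (cylCoord p) :=
    fun p hp => by
    have hdw : DifferentiableWithinAt ℝ G K (cylCoord p) :=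
      hG.differentiableOn one_ne_zero _ (subset_closure (cylCoord_mem_of_mem_cylBoxOpen hp))
    have hd : DifferentiableAt ℝ G (cylCoord p) := hdw.differentiableAt (hKn p hp)
    rw [fderivWithin_of_mem_nhds (hKn p hp)]
    exact hd.hasFDerivAt
  -- the continuous representative of the divergence on the closed box
  set g : (Fin 3 → ℝ) → ℝ := fun p =>
    p 0 * ∑ i, ⟪EuclideanSpace.basisFun (Fin 3) ℝ i,
      fderivWithin ℝ G K (cylCoord p) (EuclideanSpace.basisFun (Fin 3) ℝ i)⟫ with hg
  have hgc : ContinuousOn g (cylBox L) := by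
    have hD : ContinuousOn (fun p => fderivWithin ℝ G K (cylCoord p)) (cylBox L) :=
      (hG.continuousOn_fderivWithin hKu le_rfl).comp continuous_cylCoord.continuousOn
        fun p hp => cylCoord_mem_closure_of_mem_cylBox hp
    refine (continuous_apply 0).continuousOn.mul (continuousOn_finsetSum _ fun i _ => ?_)
    exact continuousOn_const.inner (hD.clm_apply continuousOn_const)
  have hgi : IntegrableOn g (cylBox L) := hgc.integrableOn_compact isCompact_Icc
  have heq : ∀ p ∈ cylBoxOpen L,
      ∑ i, fderiv ℝ (cylFlux G i) p (Pi.single i 1) = g p ∧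
        p 0 * VectorCalculus.divergence G (cylCoord p) = g p := fun p hp => by
    have hs := sum_fderiv_cylFlux (hGd p hp)
    have hdiv : VectorCalculus.divergence G (cylCoord p) =
        ∑ i, ⟪EuclideanSpace.basisFun (Fin 3) ℝ i,
          fderivWithin ℝ G K (cylCoord p) (EuclideanSpace.basisFun (Fin 3) ℝ i)⟫ := by
      rw [divergence_eq_sum_inner_fderiv (EuclideanSpace.basisFun (Fin 3) ℝ), (hGd p hp).fderiv]
    exact ⟨by rw [hs, hg, hdiv], by rw [hg, hdiv]⟩
  have hae1 : ∀ᵐ p ∂(volume.restrict (cylBox L)),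
      (fun p => ∑ i, fderiv ℝ (cylFlux G i) p (Pi.single i 1)) p = g p :=
    ae_restrict_cylBox_of_forall fun p hp => (heq p hp).1
  have hae2 : ∀ᵐ p ∂(volume.restrict (cylBox L)),
      (fun p => p 0 * VectorCalculus.divergence G (cylCoord p)) p = g p :=
    ae_restrict_cylBox_of_forall fun p hp => (heq p hp).2
  -- the divergence theorem on the box
  have hDT := integral_divergence_of_hasFDerivAt_off_countable' cylBoxLo (cylBoxHi L)
    (cylBoxLo_le_cylBoxHi hL) (cylFlux G) (fun i p => fderiv ℝ (cylFlux G i) p) ∅ countable_empty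
    (fun i => continuousOn_cylFlux hG.continuousOn L i)
    (fun p hp i => (differentiableAt_cylFlux (hGd p hp.1).differentiableAt i).hasFDerivAt)
    (hgi.congr_fun_ae (ae_restrict_cylBox_of_forall fun p hp => ((heq p hp).1).symm))
  -- all face terms cancel except the wall
  have hfaces : ∑ i : Fin 3,
      ((∫ y in Icc (cylBoxLo ∘ Fin.succAbove i) (cylBoxHi L ∘ Fin.succAbove i),
          cylFlux G i (Fin.insertNth i (cylBoxHi L i) y)) -
        ∫ y in Icc (cylBoxLo ∘ Fin.succAbove i) (cylBoxHi L ∘ Fin.succAbove i),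
          cylFlux G i (Fin.insertNth i (cylBoxLo i) y)) =
      ∫ y in cylWall L, ⟪G (cylCoord (Fin.insertNth 0 (1 : ℝ) y)), frameR (y 0)⟫ := by
    rw [Fin.sum_univ_three]
    simp only [cylBoxHi_zero, cylBoxLo_zero, cylBoxHi_one, cylBoxLo_one, cylBoxHi_two, cylBoxLo_two,
      (cylFlux_zero_rface' G _).1, (cylFlux_zero_rface' G _).2, cylFlux_one_thetaface,
      cylFlux_two_zface hper, integral_zero, sub_self, add_zero, sub_zero]
    rfl
  rw [integral_congr_ae hae2, ← integral_congr_ae hae1, hDT, hfaces]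

/-! ### The flux identity on the physical cell -/

/-- **Gauss–Green on the period cell of the cylinder with the flux through the wall**: for a
vector field `G` of class `C¹` on the closed cylinder `{r ≤ 1}` and `L`-periodic in `z`
(`L > 0`),
`∫_{{r<1} × (0,L)} div G dx = ∫_{[-π,π] × [0,L]} ⟪G(cos θ, sin θ, z), e_r(θ)⟫ d(θ, z)`:
the flux through the periodic ends cancels and only the wall `{r = 1}` contributes, with its
surface measure `dθ dz` (Gauss–Green; e.g. Kato–Lai 1984 §4, the integrations by parts
(4.4)–(4.10) on `Ω`; Majda–Bertozzi 2002 §3.1.1). From the box identity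
`setIntegral_mul_divergence_cylBox_eq_wallFlux` by the change to cylindrical coordinates
`setIntegral_cylinderCell_eq_integral_cylBoxOpen`. [folklore] -/
theorem setIntegral_divergence_cylinderCell_eq_wallFlux
    {G : EuclideanSpace ℝ (Fin 3) → EuclideanSpace ℝ (Fin 3)} {L : ℝ} (hL : 0 ≤ L)
    (hG : ContDiffOn ℝ 1 G (closure (unitCylinder : Set (EuclideanSpace ℝ (Fin 3)))))
    (hper : IsAxiallyPeriodic L G) :
    ∫ x in (cylinderCell L : Set (EuclideanSpace ℝ (Fin 3))), VectorCalculus.divergence G x =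
      ∫ y in cylWall L, ⟪G (cylCoord (Fin.insertNth 0 (1 : ℝ) y)), frameR (y 0)⟫ := by
  have hae : cylBoxOpen L =ᵐ[volume] cylBox L := by
    rw [volume_pi]; exact Measure.univ_pi_Ioo_ae_eq_Icc
  rw [setIntegral_cylinderCell_eq_integral_cylBoxOpen, setIntegral_congr_set hae,
    ← setIntegral_mul_divergence_cylBox_eq_wallFlux hL hG hper]
  rfl

/-! ### Integration by parts in a fixed direction -/

/-- The divergence of `φ • v` for a constant vector `v` is the directional derivative `Dφ v`.
[folklore] -/
theorem divergence_smul_const_apply {φ : EuclideanSpace ℝ (Fin 3) → ℝ}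
    {x : EuclideanSpace ℝ (Fin 3)} (hφ : DifferentiableAt ℝ φ x) (v : EuclideanSpace ℝ (Fin 3)) :
    VectorCalculus.divergence (fun y => φ y • v) x = fderiv ℝ φ x v := by
  set b := EuclideanSpace.basisFun (Fin 3) ℝ
  rw [divergence_eq_sum_inner_fderiv b, fderiv_fun_smul hφ (differentiableAt_const v)]
  simp only [fderiv_fun_const, Pi.zero_apply, smul_zero, zero_add,
    ContinuousLinearMap.smulRight_apply, inner_smul_right]
  calc ∑ i, fderiv ℝ φ x (b i) * ⟪b i, v⟫
      = fderiv ℝ φ x (∑ i, ⟪b i, v⟫ • b i) := by simp [mul_comm]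
    _ = fderiv ℝ φ x v := by rw [b.sum_repr']

/-- **Integration by parts in a fixed direction on the period cell, with the wall term**: for a
scalar `φ` of class `C¹` on the closed cylinder and `L`-periodic in `z`, and a fixed vector `v`,
`∫_{{r<1} × (0,L)} Dφ(x) v dx = ∫_{[-π,π] × [0,L]} φ(Φ(1,θ,z)) ⟪v, e_r(θ)⟫ d(θ, z)`
(`setIntegral_divergence_cylinderCell_eq_wallFlux` for `G = φ v`). [folklore] -/
theorem setIntegral_fderiv_apply_cylinderCell_eq_wallFlux {φ : EuclideanSpace ℝ (Fin 3) → ℝ}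
    {L : ℝ} (hL : 0 ≤ L)
    (hφ : ContDiffOn ℝ 1 φ (closure (unitCylinder : Set (EuclideanSpace ℝ (Fin 3)))))
    (hper : IsAxiallyPeriodic L φ) (v : EuclideanSpace ℝ (Fin 3)) :
    ∫ x in (cylinderCell L : Set (EuclideanSpace ℝ (Fin 3))), fderiv ℝ φ x v =
      ∫ y in cylWall L, φ (cylCoord (Fin.insertNth 0 (1 : ℝ) y)) * ⟪v, frameR (y 0)⟫ := by
  have hG : ContDiffOn ℝ 1 (fun y => φ y • v)
      (closure (unitCylinder : Set (EuclideanSpace ℝ (Fin 3)))) := hφ.smul contDiffOn_const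
  have hperG : IsAxiallyPeriodic L (fun y => φ y • v) := fun x => by
    simp only [hper x]
  have h := setIntegral_divergence_cylinderCell_eq_wallFlux hL hG hperG
  have hdiv : ∀ x ∈ (cylinderCell L : Set (EuclideanSpace ℝ (Fin 3))),
      VectorCalculus.divergence (fun y => φ y • v) x = fderiv ℝ φ x v := fun x hx => by
    have hxK : closure (unitCylinder : Set (EuclideanSpace ℝ (Fin 3))) ∈ 𝓝 x :=
      mem_of_superset (unitCylinder.isOpen.mem_nhds (cylinderCell_le_unitCylinder L hx))
        subset_closure
    exact divergence_smul_const_apply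
      ((hφ.differentiableOn one_ne_zero x (mem_of_mem_nhds hxK)).differentiableAt hxK) v
  rw [← setIntegral_congr_fun (cylinderCell L).isOpen.measurableSet hdiv, h]
  refine setIntegral_congr_fun ?_ fun y _ => ?_
  · rw [cylWall_eq]; exact measurableSet_Icc
  · rw [real_inner_smul_left, real_inner_comm]

end Literature.Analysis.FluidPDE
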